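import Literature.MathematicalPhysics.QuantumFieldTheory.Balaban1983to89.B12ContinuousTransportInvarianceOn

/-!
# NODE N09 — [Balaban1987RG1] p. 254 «if ρ is gauge invariant then Tρ is gauge invariant» LOCALISED: lift-invariance of the fine density ON `Ū⁻¹(S)` only ⇒
# `Tρ(V^v) = Tρ(V)` a.e. ON `S` (push-forward reading), at EVERY POINT of an open gauge-stable `S` where `Tρ` is continuous; the (0.19) density and the
# effective actions ON THE DOMAINS from LOCAL lift-invariance of the cut-offs — the engine-side exit from the (M1) obstruction

TRACK A (YM-PLAN §2d, node N09 of 28), seat `pub-ymgap-dag-n09-w2` (D-0149 width seat 2∕4), FILE 3 (CLAIM-2).  Key of record: K1⁷ `StabilityBAtRecordR13SepCoPH` =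
stmt-QuantumFields-20542; `--supports` it as a helper (Summits lane).  [I] = [Balaban1987RG1] (CMP 109), [B7] = [Balaban1985Averaging] (CMP 98).

WHY.  dag-n09-a's on-domain engine (`B12ContinuousTransportInvarianceOn`, MODULE 5) derives N09's composition input from GLOBAL lift-invariance of every (0.19) density
`ρ_j = χ_j·e^{−GF∕g_j²+A_j}` (its `stepInvOn_of_isRT_continuousOn` ∕ `invOn_effActionHT_of_stepsOn` take `LiftInvariant (χ K g j)` and push it through dag-p07's
`B12RTGaugeInvariance254.isRT_comp_gaugeAct`).  At the bare-choice Stage-13 record with the (2.9) cut-off, GLOBAL lift-invariance of `χ^{(2.9)}_j` is FALSE in print's regime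
(this seat's FILES 1–2b: the junk corner), while it holds ON `Ū⁻¹(solvable set)` under [B11] (181)-covariance of (2.3) (FILE 1 §1).  THIS FILE supplies the χ-GENERIC
engine bricks that need lift-invariance ONLY ON `Ū⁻¹(S)`:
* §1 (generic `G`): **`integral_gaugeAct_mul_eq_of_isRT_of_liftInvariantOn`** — for an `IsRT` image `ρ′` of `ρ` along a covariant averaging and a bounded measurable test
  function `f` VANISHING OFF `S`, `∫ ρ′(V^v) f(V) dV = ∫ ρ′ f dV` as soon as `ρ(U^{v∘B}) = ρ(U)` whenever `ŪU ∈ S` (dag-p07's computation verbatim: move `v` onto `f` by the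
  invariance of `dV`, `IsRT`, covariance `(ŪU)^{v⁻¹} = Ū(U^{v⁻¹∘B})`, change of variables `U ↦ U^{v∘B}`; on the support of `f∘Ū` the field averages into `S`) — NO stability
  or openness of `S` needed; **`ae_eq_restrict_gaugeAct_of_isRT_of_liftInvariantOn`** — hence `ρ′∘(·)^v = ρ′` a.e. ON a measurable `S` (test against indicators of
  measurable subsets of `S`); **`invOn_of_isRT_of_liftInvariantOn`** — and AT EVERY POINT of `S` if `S` is open, `v`-stable, `dV` charges open sets, `v` acts continuously
  and `ρ′` is continuous on `S` (Mathlib `Measure.eqOn_open_of_ae_eq`) = the `_on` twin of MODULE 5's `invOn_of_isRT_of_continuousOn`;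
  **`liftInvariantOn_integrand_of_invOn`** — the (0.19) density is lift-invariant ON a set `E` of fine fields as soon as `χ` is lift-invariant on `E`, `GF` everywhere, `A` on
  `D`, and `χ` vanishes at the points of `E` outside `D` (twin of MODULE 5's `liftInvariant_integrand_of_invOn`).
* §2 (`SU(N)`, transport families, the record's averaging): **`stepInvOn_of_isRT_continuousOn_of_liftInvariantOn`** — the per-step ON-DOMAIN mapping property from
  lift-invariance of the density met ON `Ū⁻¹(D)` only; **`invOn_effActionHT_of_stepsOnLoc`** — p. 263 on the domains: every `A_k`, `k ≤ n`, is invariant ON `D k` from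
  cut-offs `χ_j` lift-invariant ON `Ū⁻¹(D (j+1))` and vanishing there off `D j`, and the localised per-step property (induction as in MODULE 5);
  **`hCompT_of_stepsOnLoc`** — N09's composition input `HCompT` from `HRestrict` + intermediate uniqueness + nesting + the localised hypotheses (MODULE 5's
  `hCompT_of_hOrbit_of_invOn` consumed by name).
So a junction keyed on these bricks displays, instead of (M1), «`χ_j` lift-invariant on `Ū⁻¹(D (j+1))`» — which for `χ^{(2.9)}` and bookkeeping sets inside the SOLVABLE set
is FILE 1 §1's consequence of [B11] (181)-covariance (`chiFix29OfRecord_gaugeAct_liftTransf_of_covariantOn`).  LOCATED DESIGN NOTE (not settled here): the junction's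
present sets `D (i+1) := regSetOfRecord …` CONTAIN unsolvable (far) fields, where no covariance statement is available; a re-keyed junction must take `D (j+1)` inside the
level-`(j+1)` solvable set at radius `ν.εreg` (e.g. a small-field domain plus [B11] Thm 1 existence AT RADIUS `ν.εreg` — at the V17 witness `εbg = 1 ≠ εreg = a₀`), or the
record adopts the guarded cut-off (FILE 1 v1.1 §4).

HONEST FRAMING: kernel bookkeeping (measure-preserving change of variables, `IsRT`, continuity on open sets); nothing of Bałaban's asserted; the `IsRT` ∕ integrability ∕
continuity ∕ nesting ∕ [B11] inputs stay HYPOTHESES as in MODULE 5; N09 NOT discharged; K0⁷ ∕ K1⁷ OPEN; counts unmoved (typed 28∕28 · discharged 5∕27); R4 is the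
conditional finite-𝕋⁴ rung `BalabanLadder.UV` only — NOT continuum ∕ ℝ⁴ ∕ OS ∕ mass gap ∕ Clay.  THEOREMS ONLY (0 `def`, 0 `sorry`), standard axioms.
-/

noncomputable section

namespace Summit.QuantumFields.YangMills.BalabanUVNodes.N09RTGaugeInvarianceOn

open MeasureTheory
open Literature.MathematicalPhysics.QuantumFieldTheory.Balaban1983to89
open Literature.MathematicalPhysics.QuantumFieldTheory.Balaban1983to89.Node00
open B12RTGaugeInvariance254 (LiftInvariant liftTransf invTransf avg_gaugeAct_liftTransf gaugeAct_inv_gaugeAct invTransf_liftTransf measurable_gaugeAct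
  integrable_comp_gaugeAct)
open B12Eq019ActionBody (integrand integrand_apply)
open B12EffectiveActionInvarianceT (gfOfRecord_liftInvariant)
open B12ContinuousTransportInvariance (isOpenPosMeasure_fieldMeasure_SU continuous_gaugeAct_SU)
open B12ContinuousTransportInvarianceOn (invOn_effActionHT_succ_of_stepOn hCompT_of_hOrbit_of_invOn)
open GaugeField (gaugeAct)

/-! ## §1. Generic gauge group: p. 254 localised to a set `S` of coarse fields -/

section Generic

variable {P : Params} {j : ℕ} {G : Type*} [GaugeGroup G] [MeasurableSpace G] [HaarData G] [MeasurableMul₂ G]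

/-- **THE PUSH-FORWARD IDENTITY WITH A COARSE GAUGE TRANSFORMATION, LOCALISED** ([I] p. 265 «the gauge covariance of the averages implies that the δ-functions in (2.1)
are invariant under the gauge transformations V → V^v» in the δ-free reading, for test functions supported in `S`): if `ρ′` is an `IsRT` image of `ρ` along the covariant
averaging `av` (`j + 1 ≤ m + K`), `f` is bounded, measurable and vanishes off `S`, and `ρ(U^{v∘blockOf}) = ρ(U)` for every `U` with `ŪU ∈ S`, then
`∫ ρ′(V^v) f(V) dV = ∫ ρ′(V) f(V) dV`. [cite: Balaban1987RG1, (0.13) p.254 and (2.1) p.265] -/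
theorem integral_gaugeAct_mul_eq_of_isRT_of_liftInvariantOn (hj : j + 1 ≤ P.m + P.K) (av : Averaging P j G) {ρ : Density P j G}
    {ρ' : Density P (j + 1) G} (h : IsRT av.avg ρ ρ') {S : Set (GaugeField P (j + 1) G)} (v : GaugeTransf P (j + 1) G)
    (hρ : ∀ U : GaugeField P j G, av.avg U ∈ S → ρ (gaugeAct (liftTransf v) U) = ρ U)
    {f : GaugeField P (j + 1) G → ℝ} (hf : Measurable f) (hbd : ∃ C : ℝ, ∀ V, |f V| ≤ C) (hfS : ∀ V, V ∉ S → f V = 0) :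
    ∫ V, ρ' (gaugeAct v V) * f V ∂(fieldMeasure P (j + 1) G) = ∫ V, ρ' V * f V ∂(fieldMeasure P (j + 1) G) := by
  obtain ⟨C, hC⟩ := hbd
  have hf' : Measurable (fun V : GaugeField P (j + 1) G => f (gaugeAct (invTransf v) V)) := hf.comp (measurable_gaugeAct _)
  have hbd' : ∃ C : ℝ, ∀ V : GaugeField P (j + 1) G, |f (gaugeAct (invTransf v) V)| ≤ C := ⟨C, fun V => hC _⟩
  have key := h _ hf' hbd'
  calc ∫ V, ρ' (gaugeAct v V) * f V ∂(fieldMeasure P (j + 1) G)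
      = ∫ V, ρ' (gaugeAct v V) * f (gaugeAct (invTransf v) (gaugeAct v V)) ∂(fieldMeasure P (j + 1) G) := by
        simp_rw [gaugeAct_inv_gaugeAct]
    _ = ∫ V, ρ' V * f (gaugeAct (invTransf v) V) ∂(fieldMeasure P (j + 1) G) :=
        B12FaddeevPopov016.integral_comp_gaugeAct v (fun V => ρ' V * f (gaugeAct (invTransf v) V))
    _ = ∫ U, ρ U * f (gaugeAct (invTransf v) (av.avg U)) ∂(fieldMeasure P j G) := key
    _ = ∫ U, ρ U * f (av.avg (gaugeAct (liftTransf (invTransf v)) U)) ∂(fieldMeasure P j G) := by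
        simp_rw [avg_gaugeAct_liftTransf hj av (invTransf v)]
    _ = ∫ U, ρ (gaugeAct (liftTransf v) U) *
          f (av.avg (gaugeAct (liftTransf (invTransf v)) (gaugeAct (liftTransf v) U))) ∂(fieldMeasure P j G) :=
        (B12FaddeevPopov016.integral_comp_gaugeAct (liftTransf v)
          (fun U => ρ U * f (av.avg (gaugeAct (liftTransf (invTransf v)) U)))).symm
    _ = ∫ U, ρ U * f (av.avg U) ∂(fieldMeasure P j G) := by
        refine integral_congr_ae (Filter.Eventually.of_forall fun U => ?_)
        simp only
        rw [← invTransf_liftTransf, gaugeAct_inv_gaugeAct]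
        by_cases hU : av.avg U ∈ S
        · rw [hρ U hU]
        · rw [hfS _ hU, mul_zero, mul_zero]
    _ = ∫ V, ρ' V * f V ∂(fieldMeasure P (j + 1) G) := (h f hf ⟨C, hC⟩).symm

/-- **`Tρ(V^v) = Tρ(V)` FOR `dV`-ALMOST EVERY `V ∈ S`** (push-forward reading, localised): an integrable `IsRT` image `ρ′` of a density `ρ` lift-invariant on `Ū⁻¹(S)`, `S`
measurable, agrees with `ρ′∘(·)^v` almost everywhere on `S` (test `integral_gaugeAct_mul_eq_of_isRT_of_liftInvariantOn` against the indicators of the measurable subsets of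
`S`).  The `_on` twin of dag-p07's `rtOpI_gaugeInvariant_ae`. [cite: Balaban1987RG1, (0.13) p.254 and (2.1) p.265] -/
theorem ae_eq_restrict_gaugeAct_of_isRT_of_liftInvariantOn (hj : j + 1 ≤ P.m + P.K) (av : Averaging P j G) {ρ : Density P j G} {ρ' : Density P (j + 1) G}
    (h : IsRT av.avg ρ ρ') (hi : Integrable ρ' (fieldMeasure P (j + 1) G)) {S : Set (GaugeField P (j + 1) G)} (hS : MeasurableSet S)
    (v : GaugeTransf P (j + 1) G) (hρ : ∀ U : GaugeField P j G, av.avg U ∈ S → ρ (gaugeAct (liftTransf v) U) = ρ U) :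
    (fun V => ρ' (gaugeAct v V)) =ᵐ[(fieldMeasure P (j + 1) G).restrict S] ρ' := by
  have hiv : Integrable (fun V => ρ' (gaugeAct v V)) (fieldMeasure P (j + 1) G) := integrable_comp_gaugeAct hi v
  have hind : S.indicator (fun V => ρ' (gaugeAct v V)) =ᵐ[fieldMeasure P (j + 1) G] S.indicator ρ' := by
    refine Integrable.ae_eq_of_forall_setIntegral_eq _ _ (hiv.indicator hS) (hi.indicator hS) fun s hs _ => ?_
    rw [integral_indicator hS, integral_indicator hS, Measure.restrict_restrict hS, ← integral_indicator (hS.inter hs),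
      ← integral_indicator (hS.inter hs)]
    have hf : Measurable ((S ∩ s).indicator fun _ : GaugeField P (j + 1) G => (1 : ℝ)) := measurable_const.indicator (hS.inter hs)
    have hbd : ∃ C : ℝ, ∀ V, |(S ∩ s).indicator (fun _ : GaugeField P (j + 1) G => (1 : ℝ)) V| ≤ C :=
      ⟨1, fun V => by by_cases hV : V ∈ S ∩ s <;> simp [hV]⟩
    have hfS : ∀ V, V ∉ S → (S ∩ s).indicator (fun _ : GaugeField P (j + 1) G => (1 : ℝ)) V = 0 :=
      fun V hV => Set.indicator_of_notMem (fun h => hV h.1) _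
    have k₁ : (S ∩ s).indicator (fun V => ρ' (gaugeAct v V)) =
        fun V => ρ' (gaugeAct v V) * (S ∩ s).indicator (fun _ : GaugeField P (j + 1) G => (1 : ℝ)) V := by
      funext V; by_cases hV : V ∈ S ∩ s <;> simp [hV]
    have k₂ : (S ∩ s).indicator ρ' = fun V => ρ' V * (S ∩ s).indicator (fun _ : GaugeField P (j + 1) G => (1 : ℝ)) V := by
      funext V; by_cases hV : V ∈ S ∩ s <;> simp [hV]
    rw [k₁, k₂]
    exact integral_gaugeAct_mul_eq_of_isRT_of_liftInvariantOn hj av h v hρ hf hbd hfS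
  rw [Filter.EventuallyEq, ae_restrict_iff' hS]
  filter_upwards [hind] with V hV hVS
  simpa [Set.indicator_of_mem hVS] using hV

/-- **p. 254 AT EVERY POINT OF AN OPEN GAUGE-STABLE SET, FROM LOCAL LIFT-INVARIANCE** — the `_on` twin of MODULE 5's `invOn_of_isRT_of_continuousOn`: if moreover `S` is
open and `v`-stable, each coarse gauge transformation acts continuously, `dV` charges open sets and `ρ′` is continuous ON `S`, then `ρ′(V^v) = ρ′(V)` for EVERY `V ∈ S`
(Mathlib `Measure.eqOn_open_of_ae_eq`). [cite: Balaban1987RG1, (0.13) p.254, (2.1) p.265 and p.263] -/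
theorem invOn_of_isRT_of_liftInvariantOn [TopologicalSpace G] [(fieldMeasure P (j + 1) G).IsOpenPosMeasure]
    (hact : ∀ v : GaugeTransf P (j + 1) G, Continuous (gaugeAct v : GaugeField P (j + 1) G → GaugeField P (j + 1) G))
    (hj : j + 1 ≤ P.m + P.K) (av : Averaging P j G) {ρ : Density P j G} {ρ' : Density P (j + 1) G} (h : IsRT av.avg ρ ρ')
    (hi : Integrable ρ' (fieldMeasure P (j + 1) G)) {S : Set (GaugeField P (j + 1) G)} (hSo : IsOpen S) (hS : MeasurableSet S)
    (hSst : ∀ (v : GaugeTransf P (j + 1) G) (V : GaugeField P (j + 1) G), V ∈ S → gaugeAct v V ∈ S) (hc : ContinuousOn ρ' S)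
    (hρ : ∀ (v : GaugeTransf P (j + 1) G) (U : GaugeField P j G), av.avg U ∈ S → ρ (gaugeAct (liftTransf v) U) = ρ U) :
    ∀ (v : GaugeTransf P (j + 1) G) (V : GaugeField P (j + 1) G), V ∈ S → ρ' (gaugeAct v V) = ρ' V := fun v _ hV =>
  Measure.eqOn_open_of_ae_eq (ae_eq_restrict_gaugeAct_of_isRT_of_liftInvariantOn hj av h hi hS v (hρ v)) hSo
    (hc.comp (hact v).continuousOn fun V hV => hSst v V hV) hc hV

omit [MeasurableSpace G] [HaarData G] [MeasurableMul₂ G] in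
/-- **THE (0.19) DENSITY IS LIFT-INVARIANT ON `E` FROM LOCAL DATA** (twin of MODULE 5's `liftInvariant_integrand_of_invOn`): if `χ` is lift-invariant at the points of `E`,
`GF` everywhere, `A(U^ṽ) = A(U)` on `D`, and `χ` vanishes at the points of `E` outside `D`, then `χ(U)·exp[−(1/g²)GF(U) + A(U)]` is lift-invariant at every `U ∈ E`.
[cite: Balaban1987RG1, (0.19) p.255 and p.263] -/
theorem liftInvariantOn_integrand_of_invOn {χ GF A : Density P j G} {E D : Set (GaugeField P j G)} (v : GaugeTransf P (j + 1) G)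
    (hχ : ∀ U ∈ E, χ (gaugeAct (liftTransf v) U) = χ U) (hGF : LiftInvariant GF) (hχD : ∀ U ∈ E, U ∉ D → χ U = 0)
    (hA : ∀ U ∈ D, A (gaugeAct (liftTransf v) U) = A U) (gk : ℝ) :
    ∀ U ∈ E, integrand χ GF gk A (gaugeAct (liftTransf v) U) = integrand χ GF gk A U := by
  intro U hU
  rw [integrand_apply, integrand_apply, hχ U hU, hGF v U]
  by_cases hUD : U ∈ D
  · rw [hA U hUD]
  · rw [hχD U hU hUD, zero_mul, zero_mul]

end Generic

/-! ## §2. `G = SU(N)`: the localised per-step property, p. 263 on the domains, `HCompT` -/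

variable {F : T4Continuum.T4Family} {N : ℕ} [NeZero N]

/-- **THE PER-STEP ON-DOMAIN MAPPING PROPERTY FROM LOCAL LIFT-INVARIANCE** (transport family `T`, torus `K`, step `j + 1 ≤ m + K`; the `_on` twin of MODULE 5's
`stepInvOn_of_isRT_continuousOn`): if `T K j ρ_j` is an `IsRT` image of the (0.19) density `ρ_j` met at step `j`, integrable and continuous ON an open, measurable,
gauge-stable set `D` of coarse fields, then lift-invariance of `ρ_j` ON `Ū⁻¹(D)` gives `T K j ρ_j (V^v) = T K j ρ_j (V)` at every `V ∈ D`.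
[cite: Balaban1987RG1, (0.13) p.254, (0.19) p.255 and p.263] -/
theorem stepInvOn_of_isRT_continuousOn_of_liftInvariantOn (T : Transport F N) (χ : (K : ℕ) → (ℕ → ℝ) → (k : ℕ) → Density (F.P K) k (SU N)) (K : ℕ) (g : ℕ → ℝ)
    {j : ℕ} (hj : j + 1 ≤ (F.P K).m + (F.P K).K) {D : Set (GaugeField (F.P K) (j + 1) (SU N))} (hDo : IsOpen D) (hD : MeasurableSet D)
    (hDst : ∀ (v : GaugeTransf (F.P K) (j + 1) (SU N)) (V : GaugeField (F.P K) (j + 1) (SU N)), V ∈ D → gaugeAct v V ∈ D)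
    (hRT : IsRT (avOfRecord F N K j).avg (integrand (χ K g j) (gfOfRecord F N K j) (g j) (effActionHT F N T χ K g j))
      (T K j (integrand (χ K g j) (gfOfRecord F N K j) (g j) (effActionHT F N T χ K g j))))
    (hint : Integrable (T K j (integrand (χ K g j) (gfOfRecord F N K j) (g j) (effActionHT F N T χ K g j))) (fieldMeasure (F.P K) (j + 1) (SU N)))
    (hcont : ContinuousOn (T K j (integrand (χ K g j) (gfOfRecord F N K j) (g j) (effActionHT F N T χ K g j))) D)
    (hρ : ∀ (v : GaugeTransf (F.P K) (j + 1) (SU N)) (U : GaugeField (F.P K) j (SU N)), (avOfRecord F N K j).avg U ∈ D →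
      integrand (χ K g j) (gfOfRecord F N K j) (g j) (effActionHT F N T χ K g j) (gaugeAct (liftTransf v) U) =
        integrand (χ K g j) (gfOfRecord F N K j) (g j) (effActionHT F N T χ K g j) U) :
    ∀ (v : GaugeTransf (F.P K) (j + 1) (SU N)) (V : GaugeField (F.P K) (j + 1) (SU N)), V ∈ D →
      T K j (integrand (χ K g j) (gfOfRecord F N K j) (g j) (effActionHT F N T χ K g j)) (gaugeAct v V) =
        T K j (integrand (χ K g j) (gfOfRecord F N K j) (g j) (effActionHT F N T χ K g j)) V :=
  haveI := isOpenPosMeasure_fieldMeasure_SU N (F.P K) (j + 1)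
  invOn_of_isRT_of_liftInvariantOn (continuous_gaugeAct_SU N (F.P K) (j + 1)) hj (avOfRecord F N K j) hRT hint hDo hD hDst hcont hρ

/-- **THE EFFECTIVE ACTIONS ARE GAUGE INVARIANT ON THE DOMAINS FROM LOCAL LIFT-INVARIANCE OF THE CUT-OFFS** (p. 263; the localised twin of MODULE 5's
`invOn_effActionHT_of_stepsOn`): for `n ≤ m + K`, bookkeeping sets `D j`, cut-offs `χ_j` lift-invariant ON `Ū⁻¹(D (j+1))` and vanishing there off `D j` (`j < n`), and the
LOCALISED per-step property («if `ρ_j` is lift-invariant on `Ū⁻¹(D (j+1))` then `T K j ρ_j` is invariant on `D (j+1)`», `j < n`), every `A_k`, `k ≤ n`, satisfies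
`A_k(V^v) = A_k(V)` for all `V ∈ D k` (induction on `k`; `A_0` everywhere). [cite: Balaban1987RG1, p.263, (0.13) p.254 and (0.19) p.255] -/
theorem invOn_effActionHT_of_stepsOnLoc (T : Transport F N) (χ : (K : ℕ) → (ℕ → ℝ) → (k : ℕ) → Density (F.P K) k (SU N)) (K : ℕ) (g : ℕ → ℝ)
    {n : ℕ} (hn : n ≤ (F.P K).m + (F.P K).K) (D : (j : ℕ) → Set (GaugeField (F.P K) j (SU N)))
    (hχ : ∀ j < n, ∀ (v : GaugeTransf (F.P K) (j + 1) (SU N)) (U : GaugeField (F.P K) j (SU N)), (avOfRecord F N K j).avg U ∈ D (j + 1) →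
      χ K g j (gaugeAct (liftTransf v) U) = χ K g j U)
    (hχD : ∀ j < n, ∀ U : GaugeField (F.P K) j (SU N), (avOfRecord F N K j).avg U ∈ D (j + 1) → U ∉ D j → χ K g j U = 0)
    (hstep : ∀ j < n, (∀ (v : GaugeTransf (F.P K) (j + 1) (SU N)) (U : GaugeField (F.P K) j (SU N)), (avOfRecord F N K j).avg U ∈ D (j + 1) →
        integrand (χ K g j) (gfOfRecord F N K j) (g j) (effActionHT F N T χ K g j) (gaugeAct (liftTransf v) U) =
          integrand (χ K g j) (gfOfRecord F N K j) (g j) (effActionHT F N T χ K g j) U) →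
      ∀ (v : GaugeTransf (F.P K) (j + 1) (SU N)) (V : GaugeField (F.P K) (j + 1) (SU N)), V ∈ D (j + 1) →
        T K j (integrand (χ K g j) (gfOfRecord F N K j) (g j) (effActionHT F N T χ K g j)) (gaugeAct v V) =
          T K j (integrand (χ K g j) (gfOfRecord F N K j) (g j) (effActionHT F N T χ K g j)) V) :
    ∀ k ≤ n, ∀ (v : GaugeTransf (F.P K) k (SU N)) (V : GaugeField (F.P K) k (SU N)), V ∈ D k →
      effActionHT F N T χ K g k (gaugeAct v V) = effActionHT F N T χ K g k V := by
  intro k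
  induction k with
  | zero =>
    intro _ v V _
    rw [effActionHT_zero]
    exact T4WilsonGaugeFlatDirection.gaugeInvariant_wilsonExponent _ _ v V
  | succ k ih =>
    intro hk
    have hk' : k < n := Nat.lt_of_succ_le hk
    refine invOn_effActionHT_succ_of_stepOn T χ K g k (hstep k hk' fun v U hU => ?_)
    exact liftInvariantOn_integrand_of_invOn v (fun U' hU' => hχ k hk' v U' hU') (gfOfRecord_liftInvariant F N K ((Nat.succ_le_of_lt hk').trans hn))
      (fun U' hU' hUD => hχD k hk' U' hU' hUD) (fun U' hU' => ih hk'.le (liftTransf v) U' hU') (g k) U hU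

/-- Under the same localised hypotheses every (0.19) density met at a step `j < n` is lift-invariant ON `Ū⁻¹(D (j+1))`. [cite: Balaban1987RG1, (0.19) p.255 and p.263] -/
theorem liftInvariantOn_integrand_of_stepsOnLoc (T : Transport F N) (χ : (K : ℕ) → (ℕ → ℝ) → (k : ℕ) → Density (F.P K) k (SU N)) (K : ℕ) (g : ℕ → ℝ)
    {n : ℕ} (hn : n ≤ (F.P K).m + (F.P K).K) (D : (j : ℕ) → Set (GaugeField (F.P K) j (SU N)))
    (hχ : ∀ j < n, ∀ (v : GaugeTransf (F.P K) (j + 1) (SU N)) (U : GaugeField (F.P K) j (SU N)), (avOfRecord F N K j).avg U ∈ D (j + 1) →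
      χ K g j (gaugeAct (liftTransf v) U) = χ K g j U)
    (hχD : ∀ j < n, ∀ U : GaugeField (F.P K) j (SU N), (avOfRecord F N K j).avg U ∈ D (j + 1) → U ∉ D j → χ K g j U = 0)
    (hstep : ∀ j < n, (∀ (v : GaugeTransf (F.P K) (j + 1) (SU N)) (U : GaugeField (F.P K) j (SU N)), (avOfRecord F N K j).avg U ∈ D (j + 1) →
        integrand (χ K g j) (gfOfRecord F N K j) (g j) (effActionHT F N T χ K g j) (gaugeAct (liftTransf v) U) =
          integrand (χ K g j) (gfOfRecord F N K j) (g j) (effActionHT F N T χ K g j) U) →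
      ∀ (v : GaugeTransf (F.P K) (j + 1) (SU N)) (V : GaugeField (F.P K) (j + 1) (SU N)), V ∈ D (j + 1) →
        T K j (integrand (χ K g j) (gfOfRecord F N K j) (g j) (effActionHT F N T χ K g j)) (gaugeAct v V) =
          T K j (integrand (χ K g j) (gfOfRecord F N K j) (g j) (effActionHT F N T χ K g j)) V) :
    ∀ j < n, ∀ (v : GaugeTransf (F.P K) (j + 1) (SU N)) (U : GaugeField (F.P K) j (SU N)), (avOfRecord F N K j).avg U ∈ D (j + 1) →
      integrand (χ K g j) (gfOfRecord F N K j) (g j) (effActionHT F N T χ K g j) (gaugeAct (liftTransf v) U) =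
        integrand (χ K g j) (gfOfRecord F N K j) (g j) (effActionHT F N T χ K g j) U := fun j hj v =>
  liftInvariantOn_integrand_of_invOn v (fun U' hU' => hχ j hj v U' hU') (gfOfRecord_liftInvariant F N K ((Nat.succ_le_of_lt hj).trans hn))
    (fun U' hU' hUD => hχD j hj U' hU' hUD) (fun U' hU' => invOn_effActionHT_of_stepsOnLoc T χ K g hn D hχ hχD hstep j hj.le (liftTransf v) U' hU') (g j)

/-- **`HCompT` FROM THE [B11] INPUTS + NESTING + THE LOCALISED HYPOTHESES** at every level `k ≤ n` (`n ≤ K`): `HRestrict` + intermediate (1.1)-uniqueness ⇒ `HOrbit`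
(`Node00.hOrbit_of_hRestrict_of_unique`); on-domain invariance of the actions from `invOn_effActionHT_of_stepsOnLoc`; then MODULE 5's `hCompT_of_hOrbit_of_invOn`.
[cite: Balaban1987RG1, (0.21)–(0.23) p.256, (1.1)–(1.2) p.260, p.263 and (2.16) p.269; Balaban1985Variational, Thm 1 (8)–(10) p.279] -/
theorem hCompT_of_stepsOnLoc (T : Transport F N) (χ : (K : ℕ) → (ℕ → ℝ) → (k : ℕ) → Density (F.P K) k (SU N)) {ε : ℝ} (K : ℕ) (g : ℕ → ℝ)
    {n : ℕ} (hn : n ≤ K) (D : (j : ℕ) → Set (GaugeField (F.P K) j (SU N)))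
    (hχ : ∀ j < n, ∀ (v : GaugeTransf (F.P K) (j + 1) (SU N)) (U : GaugeField (F.P K) j (SU N)), (avOfRecord F N K j).avg U ∈ D (j + 1) →
      χ K g j (gaugeAct (liftTransf v) U) = χ K g j U)
    (hχD : ∀ j < n, ∀ U : GaugeField (F.P K) j (SU N), (avOfRecord F N K j).avg U ∈ D (j + 1) → U ∉ D j → χ K g j U = 0)
    (hstep : ∀ j < n, (∀ (v : GaugeTransf (F.P K) (j + 1) (SU N)) (U : GaugeField (F.P K) j (SU N)), (avOfRecord F N K j).avg U ∈ D (j + 1) →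
        integrand (χ K g j) (gfOfRecord F N K j) (g j) (effActionHT F N T χ K g j) (gaugeAct (liftTransf v) U) =
          integrand (χ K g j) (gfOfRecord F N K j) (g j) (effActionHT F N T χ K g j) U) →
      ∀ (v : GaugeTransf (F.P K) (j + 1) (SU N)) (V : GaugeField (F.P K) (j + 1) (SU N)), V ∈ D (j + 1) →
        T K j (integrand (χ K g j) (gfOfRecord F N K j) (g j) (effActionHT F N T χ K g j)) (gaugeAct v V) =
          T K j (integrand (χ K g j) (gfOfRecord F N K j) (g j) (effActionHT F N T χ K g j)) V)
    {k : ℕ} (hk : k ≤ n) {dom : Set (GaugeField (F.P K) k (SU N))} (hres : HRestrict F N ε K k dom)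
    (huniq : ∀ V ∈ dom, ∀ j < k, UniqueUkOrbit F N K (j + 1) ε (Averaging.iter (avOfRecord F N K) (j + 1) (Uk F N K k ε V)))
    (hnest : ∀ V ∈ dom, ∀ j < k, Averaging.iter (avOfRecord F N K) j (Uk F N K k ε V) ∈ D j) :
    HCompT F N T χ ε K g k dom :=
  have hn' : n ≤ (F.P K).m + (F.P K).K := hn.trans (Nat.le_add_left _ _)
  hCompT_of_hOrbit_of_invOn T χ K g (hk.trans hn') (hOrbit_of_hRestrict_of_unique F N hres huniq) D
    (fun j hj v W hW => invOn_effActionHT_of_stepsOnLoc T χ K g hn' D hχ hχD hstep j (hj.le.trans hk) v W hW) hnest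

/-! ## §3. The Theorem-3 member through the stage-free plug, from the LOCALISED hypotheses (twin of MODULE 5 §3) -/

section Plug

open DagBinding
open FlowStep (HBeta prefixOf)
open FlowStepRuns (genSeq genFlow)
open T4FlagMemory (extd)
open B12NodeKnitIndAPlug (thm3Member_of_indATPlug_of_hCompT)
open B12NodeKnitRecord8 (b12_main_of_leaf_of_thm3Member)

variable {w : WorldP} {P : B12.RunParams} (T' : Transport F N) (χ : (K : ℕ) → (ℕ → ℝ) → (k : ℕ) → Density (F.P K) k (SU N)) (ε : ℝ)
  (β : HBeta) (dom : (k : ℕ) → Set (GaugeField (F.P P.K) k (SU N))) (D : (j : ℕ) → Set (GaugeField (F.P P.K) j (SU N)))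
  (hflow : (w.C P).flow = genFlow β P.g0)
  (hind : ∀ k, k ≤ P.K → ((w.C P).IndAss k ↔
    IndAOfRecordT F N T' χ ε β P k (prefixOf (genSeq β P.g0) k) (dom k) (effActionOfRecordT F N T' χ β P k) (wilsonBGOfRecord F N ε P k)
      (EkOfRecordT F N T' χ ε β P k)))
  (hχ : ∀ k, k ≤ P.K → ∀ n ≤ k, χ P.K (extd (prefixOf (genSeq β P.g0) k)) n = χ P.K (genSeq β P.g0) n)

include hflow hind hχ in
/-- **THE MEMBER OVER A TRANSPORT WITH THE LOCALISED PER-STEP PROPERTY, FROM [B11] THM 1 + NESTING** — the twin of MODULE 5's `thm3Member_of_indATPlug_of_stepsOn` with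
«`χ_j` lift-invariant» replaced by «`χ_j` lift-invariant ON `Ū⁻¹(D (j+1))`», «`χ_j` vanishes off `D j`» by «… at the points of `Ū⁻¹(D (j+1))`», and the per-step property
by its localised form: for a binding world whose run flow is `genFlow β P.g₀` and whose `IndAss k` IS `IndAOfRecordT T' χ ε β …`, the Theorem-3 member
`smallCouplings → smallFieldInductive` follows (`B12NodeKnitIndAPlug.thm3Member_of_indATPlug_of_hCompT` + `hCompT_of_stepsOnLoc`).
[cite: Balaban1987RG1, Thm 3 p.264, (1.1)–(1.3) p.260, p.263 and (2.16) p.269; Balaban1985Variational, Thm 1 p.279] -/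
theorem thm3Member_of_indATPlug_of_stepsOnLoc
    (hχinv : ∀ j < P.K, ∀ (v : GaugeTransf (F.P P.K) (j + 1) (SU N)) (U : GaugeField (F.P P.K) j (SU N)), (avOfRecord F N P.K j).avg U ∈ D (j + 1) →
      χ P.K (genSeq β P.g0) j (gaugeAct (liftTransf v) U) = χ P.K (genSeq β P.g0) j U)
    (hχD : ∀ j < P.K, ∀ U : GaugeField (F.P P.K) j (SU N), (avOfRecord F N P.K j).avg U ∈ D (j + 1) → U ∉ D j → χ P.K (genSeq β P.g0) j U = 0)
    (hstep : ∀ j < P.K, (∀ (v : GaugeTransf (F.P P.K) (j + 1) (SU N)) (U : GaugeField (F.P P.K) j (SU N)), (avOfRecord F N P.K j).avg U ∈ D (j + 1) →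
        integrand (χ P.K (genSeq β P.g0) j) (gfOfRecord F N P.K j) (genSeq β P.g0 j) (effActionHT F N T' χ P.K (genSeq β P.g0) j) (gaugeAct (liftTransf v) U) =
          integrand (χ P.K (genSeq β P.g0) j) (gfOfRecord F N P.K j) (genSeq β P.g0 j) (effActionHT F N T' χ P.K (genSeq β P.g0) j) U) →
      ∀ (v : GaugeTransf (F.P P.K) (j + 1) (SU N)) (V : GaugeField (F.P P.K) (j + 1) (SU N)), V ∈ D (j + 1) →
        T' P.K j (integrand (χ P.K (genSeq β P.g0) j) (gfOfRecord F N P.K j) (genSeq β P.g0 j) (effActionHT F N T' χ P.K (genSeq β P.g0) j))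
            (gaugeAct v V) =
          T' P.K j (integrand (χ P.K (genSeq β P.g0) j) (gfOfRecord F N P.K j) (genSeq β P.g0 j) (effActionHT F N T' χ P.K (genSeq β P.g0) j)) V)
    (h11 : ∀ k, k ≤ P.K → ∀ V ∈ dom k, UkExists F N P.K k ε V ∧ UniqueUkOrbit F N P.K k ε V)
    (hres : ∀ k, k ≤ P.K → HRestrict F N ε P.K k (dom k))
    (huniq : ∀ k, k ≤ P.K → ∀ V ∈ dom k, ∀ j < k,
      UniqueUkOrbit F N P.K (j + 1) ε (Averaging.iter (avOfRecord F N P.K) (j + 1) (Uk F N P.K k ε V)))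
    (hnest : ∀ k, k ≤ P.K → ∀ V ∈ dom k, ∀ j < k, Averaging.iter (avOfRecord F N P.K) j (Uk F N P.K k ε V) ∈ D j) :
    (leavesP w P).smallCouplings → (leavesP w P).smallFieldInductive :=
  thm3Member_of_indATPlug_of_hCompT T' χ ε β dom hflow hind hχ h11 fun k hk =>
    hCompT_of_stepsOnLoc T' χ P.K (genSeq β P.g0) le_rfl D hχinv hχD hstep hk (hres k hk) (huniq k hk) (hnest k hk)

include hflow hind hχ in
/-- **N09 AT `(w, P)` OVER SUCH A TRANSPORT**: its own leaf `b12` + the inputs of `thm3Member_of_indATPlug_of_stepsOnLoc` ⇒ `Dag.B12_main (leavesP w P)`.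
[cite: Balaban1987RG1, Lemma 4 (3.53) p.280, Thm 3 p.264 and (1.1)–(1.3) p.260] -/
theorem b12_main_of_indATPlug_of_leaf_of_stepsOnLoc (h12 : (leavesP w P).b12)
    (hχinv : ∀ j < P.K, ∀ (v : GaugeTransf (F.P P.K) (j + 1) (SU N)) (U : GaugeField (F.P P.K) j (SU N)), (avOfRecord F N P.K j).avg U ∈ D (j + 1) →
      χ P.K (genSeq β P.g0) j (gaugeAct (liftTransf v) U) = χ P.K (genSeq β P.g0) j U)
    (hχD : ∀ j < P.K, ∀ U : GaugeField (F.P P.K) j (SU N), (avOfRecord F N P.K j).avg U ∈ D (j + 1) → U ∉ D j → χ P.K (genSeq β P.g0) j U = 0)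
    (hstep : ∀ j < P.K, (∀ (v : GaugeTransf (F.P P.K) (j + 1) (SU N)) (U : GaugeField (F.P P.K) j (SU N)), (avOfRecord F N P.K j).avg U ∈ D (j + 1) →
        integrand (χ P.K (genSeq β P.g0) j) (gfOfRecord F N P.K j) (genSeq β P.g0 j) (effActionHT F N T' χ P.K (genSeq β P.g0) j) (gaugeAct (liftTransf v) U) =
          integrand (χ P.K (genSeq β P.g0) j) (gfOfRecord F N P.K j) (genSeq β P.g0 j) (effActionHT F N T' χ P.K (genSeq β P.g0) j) U) →
      ∀ (v : GaugeTransf (F.P P.K) (j + 1) (SU N)) (V : GaugeField (F.P P.K) (j + 1) (SU N)), V ∈ D (j + 1) →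
        T' P.K j (integrand (χ P.K (genSeq β P.g0) j) (gfOfRecord F N P.K j) (genSeq β P.g0 j) (effActionHT F N T' χ P.K (genSeq β P.g0) j))
            (gaugeAct v V) =
          T' P.K j (integrand (χ P.K (genSeq β P.g0) j) (gfOfRecord F N P.K j) (genSeq β P.g0 j) (effActionHT F N T' χ P.K (genSeq β P.g0) j)) V)
    (h11 : ∀ k, k ≤ P.K → ∀ V ∈ dom k, UkExists F N P.K k ε V ∧ UniqueUkOrbit F N P.K k ε V)
    (hres : ∀ k, k ≤ P.K → HRestrict F N ε P.K k (dom k))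
    (huniq : ∀ k, k ≤ P.K → ∀ V ∈ dom k, ∀ j < k,
      UniqueUkOrbit F N P.K (j + 1) ε (Averaging.iter (avOfRecord F N P.K) (j + 1) (Uk F N P.K k ε V)))
    (hnest : ∀ k, k ≤ P.K → ∀ V ∈ dom k, ∀ j < k, Averaging.iter (avOfRecord F N P.K) j (Uk F N P.K k ε V) ∈ D j) :
    Dag.B12_main (leavesP w P) :=
  b12_main_of_leaf_of_thm3Member h12
    (thm3Member_of_indATPlug_of_stepsOnLoc T' χ ε β dom D hflow hind hχ hχinv hχD hstep h11 hres huniq hnest)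

end Plug

end Summit.QuantumFields.YangMills.BalabanUVNodes.N09RTGaugeInvarianceOn
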